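import Literature.Probability.Process.BrownianVec
import Literature.Probability.Process.BrownianPair
import Literature.Probability.Process.BrownianRunningSup
import Literature.Probability.Distributions.GaussianSlabs
import Mathlib.Analysis.Complex.ExponentialBounds
import Mathlib.Analysis.Real.Pi.Bounds
import HarnessLib

/-!
# A model of planar (two-dimensional) Brownian motion on `WienerPair`; Gaussian small-ball bounds

Topic `Probability/Process`. The hypothesis structure `IsBrownianVec` of `BrownianVec`
(`d`-dimensional Brownian motion: measurable marginals, continuous paths, the weak Markov property
at deterministic times, Gaussian marginals `gaussVec d t`) is realised for `d = 2` on the tree's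
space `WienerPair` of pairs of independent canonical Brownian motions (`BrownianPair`:
`wienerPair = preWienerMeasure ⊗ preWienerMeasure`, `pairShift`, `pairPast`, `pairPath`,
`indepFun_pairShift_pairPast`, `map_pairShift_wienerPair`, `map_pairPath_wienerPair`), exactly as
the four-dimensional model `BrownianVecModel` does for `WienerPair × WienerPair`:

* `isBrownianVec_planar : IsBrownianVec (fun t ω ↦ ![B_t(ω₁), B_t(ω₂)]) wienerPair` — the planar Brownian
  motion of the pair, written as an explicit vector-valued process (no new definition; its complex form is
  `RandomPlanarGeometry.BrownianLoop.planarBrownian`);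
* elementary bounds for the Gaussian vector `gaussVec d h = N(0, h I_d)` on sup-norm balls:
  `gaussVec_closedBall_le` (`P(‖ξ − y‖ ≤ η) ≤ (2η/√(2πh))^d`) and, for `d = 2`, `h = 1`, the lower
  bound `gaussVec_two_one_closedBall_ge` (`P(‖ξ‖ ≤ η) ≥ η²/5` for `η ≤ 1`);
* the running supremum of the pair `max (runSup h ω₁) (runSup h ω₂)`, which dominates the sup norm of
  the planar Brownian motion at times `s ≤ h` (`norm_planar_le_max_runSup`) and has the polynomial tail of `BrownianRunningSup`
  (`measure_max_runSup_ge_le`).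

These are the model-specific inputs of the planar hitting estimates used for the finiteness of the
Brownian loop masses `Λ(K₁, K₂; D)` (`RandomPlanarGeometry/BrownianLoopMeasure`). Everything is
proved; no named fact is introduced.

## References

* J.-F. Le Gall, *Brownian Motion, Martingales, and Stochastic Calculus*, GTM 274 (2016), Ch. 2
  (canonical construction; simple Markov property). [Legall2016]
* O. Kallenberg, *Foundations of Modern Probability* (2002), Lemma 3.10, Thm. 13.5. [folklore]
-/

noncomputable section

open MeasureTheory ProbabilityTheory Filter Topology Set
open scoped NNReal ENNReal BigOperators

namespace Literature.Probability.Process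

/-! ### The planar Brownian motion of the pair -/

/-- The assembling map is measurable. [folklore] -/
theorem measurable_planarAssemble :
    Measurable (fun (p : (ℝ≥0 → ℝ) × (ℝ≥0 → ℝ)) (u : ℝ≥0) ↦ (![p.1 u, p.2 u] : Fin 2 → ℝ)) := by
  refine measurable_pi_lambda _ fun u ↦ measurable_pi_lambda _ fun i ↦ ?_
  fin_cases i <;> simp <;> fun_prop

/-- The vector path is the assembled pair of paths. [folklore] -/
theorem vecPath_planar :
    vecPath (fun (t : ℝ≥0) (ω : WienerPair) ↦ (![brownian t ω.1, brownian t ω.2] : Fin 2 → ℝ)) =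
      (fun (p : (ℝ≥0 → ℝ) × (ℝ≥0 → ℝ)) (u : ℝ≥0) ↦ (![p.1 u, p.2 u] : Fin 2 → ℝ)) ∘ pairPath := by
  funext ω u i
  fin_cases i <;> rfl

/-- The shifted vector path is the assembled pair of shifted paths. [folklore] -/
theorem vecShift_planar (s : ℝ≥0) :
    vecShift (fun (t : ℝ≥0) (ω : WienerPair) ↦ (![brownian t ω.1, brownian t ω.2] : Fin 2 → ℝ)) s =
      (fun (p : (ℝ≥0 → ℝ) × (ℝ≥0 → ℝ)) (u : ℝ≥0) ↦ (![p.1 u, p.2 u] : Fin 2 → ℝ)) ∘ pairShift s := by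
  funext ω u i
  fin_cases i <;> rfl

/-- The past of the vector path is the assembled pair of pasts, read on `Iic s`. [folklore] -/
theorem vecPast_planar (s : ℝ≥0) :
    vecPast (fun (t : ℝ≥0) (ω : WienerPair) ↦ (![brownian t ω.1, brownian t ω.2] : Fin 2 → ℝ)) s =
      (fun (p : (Iic s → ℝ) × (Iic s → ℝ)) (u : Iic s) ↦ (![p.1 u, p.2 u] : Fin 2 → ℝ)) ∘ pairPast s := by
  funext ω u i
  fin_cases i <;> rfl

/-- The marginals of the planar Brownian motion are measurable. [folklore] -/
theorem measurable_planar (t : ℝ≥0) :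
    Measurable fun ω : WienerPair ↦ (![brownian t ω.1, brownian t ω.2] : Fin 2 → ℝ) := by
  refine measurable_pi_lambda _ fun i ↦ ?_
  fin_cases i
  · exact (measurable_brownian t).comp measurable_fst
  · exact (measurable_brownian t).comp measurable_snd

/-- Every path of the planar Brownian motion is continuous. [folklore] -/
theorem continuous_planar (ω : WienerPair) :
    Continuous fun t : ℝ≥0 ↦ (![brownian t ω.1, brownian t ω.2] : Fin 2 → ℝ) :=
  continuous_pi fun i ↦ by
    fin_cases i
    · exact continuous_brownian ω.1
    · exact continuous_brownian ω.2

/-- The planar Brownian motion starts at the origin. [folklore] -/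
theorem planar_zero (ω : WienerPair) : (![brownian 0 ω.1, brownian 0 ω.2] : Fin 2 → ℝ) = 0 := by
  funext i
  fin_cases i <;> simp [brownian_zero]

/-- **The one-time marginal of the planar Brownian motion is `N(0, t I₂)`.** [folklore] -/
theorem map_planar (t : ℝ≥0) :
    wienerPair.map (fun ω : WienerPair ↦ (![brownian t ω.1, brownian t ω.2] : Fin 2 → ℝ)) = gaussVec 2 t := by
  haveI := RandomPlanarGeometry.isProbabilityMeasure_preWienerMeasure'
  symm
  refine Measure.pi_eq fun s hs ↦ ?_
  rw [Measure.map_apply (measurable_planar t) (MeasurableSet.univ_pi hs)]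
  set A : Fin 2 → Set (ℝ≥0 → ℝ) := fun i ↦ brownian t ⁻¹' s i with hA
  have hpre : (fun ω : WienerPair ↦ (![brownian t ω.1, brownian t ω.2] : Fin 2 → ℝ)) ⁻¹' Set.pi univ s =
      A 0 ×ˢ A 1 := by
    ext ω
    simp only [Set.mem_preimage, Set.mem_univ_pi, Set.mem_prod, hA]
    constructor
    · intro h
      exact ⟨by simpa using h 0, by simpa using h 1⟩
    · rintro ⟨h0, h1⟩ i
      fin_cases i
      · simpa using h0
      · simpa using h1
  have hlaw : ∀ i, preWienerMeasure (A i) = gaussianReal 0 t (s i) := fun i ↦ by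
    rw [hA, ← Measure.map_apply (measurable_brownian t) (hs i),
      (RandomPlanarGeometry.isPreBrownianReal_brownian.hasLaw_eval t).map_eq]
  rw [hpre, wienerPair, Measure.prod_prod, hlaw, hlaw, Fin.prod_univ_two]

/-- **Two independent canonical Brownian motions form a planar Brownian motion** in the sense of
`IsBrownianVec` (`d = 2`): the process `(t, ω) ↦ ![B_t(ω₁), B_t(ω₂)]` on `(WienerPair, wienerPair)`.
[cite: Legall2016, Ch. 2 (simple Markov property of Brownian motion)] -/
theorem isBrownianVec_planar :
    IsBrownianVec (fun (t : ℝ≥0) (ω : WienerPair) ↦ (![brownian t ω.1, brownian t ω.2] : Fin 2 → ℝ))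
      wienerPair where
  measurable := measurable_planar
  continuous_path := continuous_planar
  apply_zero := planar_zero
  indep_shift s := by
    rw [vecShift_planar, vecPast_planar]
    refine (indepFun_pairShift_pairPast s).comp measurable_planarAssemble ?_
    refine measurable_pi_lambda _ fun u ↦ measurable_pi_lambda _ fun i ↦ ?_
    fin_cases i <;> simp <;> fun_prop
  map_shift s := by
    rw [vecShift_planar, vecPath_planar,
      ← Measure.map_map measurable_planarAssemble (measurable_pairShift s),
      ← Measure.map_map measurable_planarAssemble measurable_pairPath,
      map_pairShift_wienerPair, map_pairPath_wienerPair]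
  map_apply := map_planar

/-! ### Gaussian small-ball bounds -/

/-- **Upper bound for the Gaussian measure of an interval**:
`N(0, v)([a, b]) ≤ (b - a)/√(2πv)` for `v ≠ 0` (both sides vanish if `b < a`). [folklore] -/
theorem gaussianReal_Icc_le_length_mul {v : ℝ≥0} (hv : v ≠ 0) (μ : ℝ) (a b : ℝ) :
    gaussianReal μ v (Icc a b) ≤ ENNReal.ofReal ((b - a) * (Real.sqrt (2 * Real.pi * v))⁻¹) := by
  rw [gaussianReal_apply μ hv]
  calc ∫⁻ x in Icc a b, gaussianPDF μ v x
      ≤ ∫⁻ _ in Icc a b, ENNReal.ofReal ((Real.sqrt (2 * Real.pi * v))⁻¹) :=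
        lintegral_mono fun x ↦ ENNReal.ofReal_le_ofReal (Distributions.gaussianPDFReal_le_peak μ v x)
    _ = ENNReal.ofReal ((Real.sqrt (2 * Real.pi * v))⁻¹) * volume (Icc a b) := by
        rw [setLIntegral_const]
    _ = ENNReal.ofReal ((b - a) * (Real.sqrt (2 * Real.pi * v))⁻¹) := by
        rw [Real.volume_Icc, ← ENNReal.ofReal_mul (inv_nonneg.2 (Real.sqrt_nonneg _)), mul_comm]

/-- **Gaussian measure of a sup-norm ball**: `N(0, hI_d)(B̄(y, η)) ≤ (2η/√(2πh))^d` for `h ≠ 0`,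
`η ≥ 0`. [folklore] -/
theorem gaussVec_closedBall_le {d : ℕ} {h : ℝ≥0} (hh : h ≠ 0) (y : Fin d → ℝ) {η : ℝ}
    (hη : 0 ≤ η) :
    gaussVec d h (Metric.closedBall y η) ≤
      ENNReal.ofReal ((2 * η * (Real.sqrt (2 * Real.pi * h))⁻¹) ^ d) := by
  rw [closedBall_pi y hη, gaussVec, Measure.pi_pi]
  calc ∏ i, gaussianReal 0 h (Metric.closedBall (y i) η)
      ≤ ∏ _i : Fin d, ENNReal.ofReal (2 * η * (Real.sqrt (2 * Real.pi * h))⁻¹) := by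
        refine Finset.prod_le_prod' fun i _ ↦ ?_
        rw [Real.closedBall_eq_Icc]
        refine (gaussianReal_Icc_le_length_mul hh 0 _ _).trans (le_of_eq ?_)
        congr 1
        ring
    _ = ENNReal.ofReal ((2 * η * (Real.sqrt (2 * Real.pi * h))⁻¹) ^ d) := by
        rw [Finset.prod_const, Finset.card_univ, Fintype.card_fin, ENNReal.ofReal_pow]
        positivity

/-- On `[-1, 1]` the standard Gaussian density is at least `(√(2π))⁻¹ e^{-1/2} ≥ 1/5`. [folklore] -/
theorem one_div_five_le_gaussianPDFReal {x : ℝ} (hx : |x| ≤ 1) : 1 / 5 ≤ gaussianPDFReal 0 1 x := by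
  rw [gaussianPDFReal]
  simp only [NNReal.coe_one, mul_one, sub_zero]
  -- `√(2π) ≤ 2.6` and `e^{-1/2} ≥ 0.6`
  have hpi : Real.pi ≤ 3.1416 := Real.pi_lt_d4.le
  have hsqrt : Real.sqrt (2 * Real.pi) ≤ 2.6 := by
    rw [Real.sqrt_le_left (by norm_num)]
    nlinarith
  have hsqrt_pos : 0 < Real.sqrt (2 * Real.pi) := Real.sqrt_pos.2 (by positivity)
  have hinv : (2.6 : ℝ)⁻¹ ≤ (Real.sqrt (2 * Real.pi))⁻¹ := by
    rw [inv_le_inv₀ (by norm_num) hsqrt_pos]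
    exact hsqrt
  have hx2 : x ^ 2 ≤ 1 := by
    have := abs_le.1 hx
    nlinarith
  have hexp : Real.exp (-(1 / 2 : ℝ)) ≤ Real.exp (-x ^ 2 / 2) :=
    Real.exp_le_exp.2 (by linarith)
  -- `e^{1/2} ≤ 5/3`, i.e. `e^{-1/2} ≥ 3/5`
  have hehalf : Real.exp ((1 / 2 : ℝ)) ≤ 5 / 3 := by
    have h1 : Real.exp (1 / 2 : ℝ) ^ 2 = Real.exp 1 := by
      rw [← Real.exp_nat_mul]; norm_num
    have h2 : Real.exp 1 ≤ 2.7182818286 := Real.exp_one_lt_d9.le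
    nlinarith [Real.exp_pos (1 / 2 : ℝ)]
  have hexp' : (3 / 5 : ℝ) ≤ Real.exp (-(1 / 2 : ℝ)) := by
    rw [Real.exp_neg, le_inv_comm₀ (by norm_num) (Real.exp_pos _)]
    linarith
  calc (1 / 5 : ℝ) ≤ (2.6 : ℝ)⁻¹ * (3 / 5) := by norm_num
    _ ≤ (Real.sqrt (2 * Real.pi))⁻¹ * Real.exp (-x ^ 2 / 2) :=
        mul_le_mul hinv (hexp'.trans hexp) (by norm_num) (inv_nonneg.2 hsqrt_pos.le)

/-- **Lower bound for the standard Gaussian measure of a small interval**: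
`N(0, 1)([-η, η]) ≥ 2η/5` for `0 ≤ η ≤ 1`. [folklore] -/
theorem gaussianReal_one_Icc_symm_ge {η : ℝ} (hη1 : η ≤ 1) :
    ENNReal.ofReal (2 * η / 5) ≤ gaussianReal 0 1 (Icc (-η) η) := by
  rw [gaussianReal_apply 0 one_ne_zero]
  calc ENNReal.ofReal (2 * η / 5) = ENNReal.ofReal (1 / 5) * volume (Icc (-η) η) := by
        rw [Real.volume_Icc, ← ENNReal.ofReal_mul (by norm_num)]
        congr 1
        ring
    _ = ∫⁻ _ in Icc (-η) η, ENNReal.ofReal (1 / 5) := by rw [setLIntegral_const]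
    _ ≤ ∫⁻ x in Icc (-η) η, gaussianPDF 0 1 x := by
        refine setLIntegral_mono (measurable_gaussianPDF 0 1) fun x hx ↦ ?_
        exact ENNReal.ofReal_le_ofReal (one_div_five_le_gaussianPDFReal (abs_le.2 ⟨by linarith [hx.1], by
          linarith [hx.2]⟩))

/-- **Lower bound for the planar standard Gaussian measure of a small sup-norm ball**:
`N(0, I₂)(B̄(0, η)) ≥ η²/7` for `0 ≤ η ≤ 1` (indeed `(2η/5)² = 4η²/25`). [folklore] -/
theorem gaussVec_two_one_closedBall_ge {η : ℝ} (hη0 : 0 ≤ η) (hη1 : η ≤ 1) :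
    ENNReal.ofReal (η ^ 2 / 7) ≤ gaussVec 2 1 (Metric.closedBall 0 η) := by
  rw [closedBall_pi _ hη0, gaussVec, Measure.pi_pi]
  calc ENNReal.ofReal (η ^ 2 / 7) ≤ ENNReal.ofReal ((2 * η / 5) ^ 2) := by
        refine ENNReal.ofReal_le_ofReal ?_
        nlinarith [sq_nonneg η]
    _ = ∏ _i : Fin 2, ENNReal.ofReal (2 * η / 5) := by
        rw [Finset.prod_const, Finset.card_univ, Fintype.card_fin, ENNReal.ofReal_pow (by positivity)]
    _ ≤ ∏ i, gaussianReal 0 1 (Metric.closedBall ((0 : Fin 2 → ℝ) i) η) := by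
        refine Finset.prod_le_prod' fun i _ ↦ ?_
        rw [Pi.zero_apply, Real.closedBall_eq_Icc, zero_sub, zero_add]
        exact gaussianReal_one_Icc_symm_ge hη1

/-! ### The running supremum of the pair -/

/-- The running supremum of the pair `max (runSup h ω₁) (runSup h ω₂)` is measurable. [folklore] -/
theorem measurable_max_runSup (h : ℝ≥0) :
    Measurable fun ω : WienerPair ↦ max (runSup h ω.1) (runSup h ω.2) :=
  ((measurable_runSup h).comp measurable_fst).max ((measurable_runSup h).comp measurable_snd)

/-- `0 ≤ max (runSup h ω₁) (runSup h ω₂)`. [folklore] -/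
theorem max_runSup_nonneg (h : ℝ≥0) (ω : WienerPair) : 0 ≤ max (runSup h ω.1) (runSup h ω.2) :=
  le_max_of_le_left (runSup_nonneg h ω.1)

/-- **`‖(B_s(ω₁), B_s(ω₂))‖ ≤ max (runSup h ω₁) (runSup h ω₂)` for `s ≤ h`** (sup norm on `ℝ²`). [folklore] -/
theorem norm_planar_le_max_runSup {h s : ℝ≥0} (hs : s ≤ h) (ω : WienerPair) :
    ‖(![brownian s ω.1, brownian s ω.2] : Fin 2 → ℝ)‖ ≤ max (runSup h ω.1) (runSup h ω.2) := by
  refine (pi_norm_le_iff_of_nonneg (max_runSup_nonneg h ω)).2 fun i ↦ ?_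
  fin_cases i
  · change ‖brownian s ω.1‖ ≤ max (runSup h ω.1) (runSup h ω.2)
    rw [Real.norm_eq_abs]
    exact (abs_brownian_le_runSup hs ω.1).trans (le_max_left _ _)
  · change ‖brownian s ω.2‖ ≤ max (runSup h ω.1) (runSup h ω.2)
    rw [Real.norm_eq_abs]
    exact (abs_brownian_le_runSup hs ω.2).trans (le_max_right _ _)

/-- **Tail of the running supremum of the pair**:
`P(max runSup ≥ a) ≤ 2 · 2h²/((a/2)² - h)²` for `a ≥ 0`, `(a/2)² > h` (union bound over the two
coordinates, `measure_runSup_ge_le`). [cite: RevuzYor1999, Ch. II Thm (1.7)] -/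
theorem measure_max_runSup_ge_le (h : ℝ≥0) {a : ℝ} (ha0 : 0 ≤ a) (ha : (h : ℝ) < (a / 2) ^ 2) :
    wienerPair {ω | a ≤ max (runSup h ω.1) (runSup h ω.2)} ≤
      2 * ENNReal.ofReal (2 * (h : ℝ) ^ 2 / ((a / 2) ^ 2 - h) ^ 2) := by
  haveI := RandomPlanarGeometry.isProbabilityMeasure_preWienerMeasure'
  have hsub : {ω : WienerPair | a ≤ max (runSup h ω.1) (runSup h ω.2)} ⊆
      (Prod.fst ⁻¹' {ω₁ | a ≤ runSup h ω₁}) ∪ (Prod.snd ⁻¹' {ω₂ | a ≤ runSup h ω₂}) := by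
    intro ω hω
    rcases le_max_iff.1 (show a ≤ max (runSup h ω.1) (runSup h ω.2) from hω) with h1 | h2
    · exact Or.inl h1
    · exact Or.inr h2
  have hS : MeasurableSet {ω₁ : ℝ≥0 → ℝ | a ≤ runSup h ω₁} :=
    measurableSet_le measurable_const (measurable_runSup h)
  have h1 : wienerPair (Prod.fst ⁻¹' {ω₁ | a ≤ runSup h ω₁}) ≤
      ENNReal.ofReal (2 * (h : ℝ) ^ 2 / ((a / 2) ^ 2 - h) ^ 2) := by
    rw [wienerPair, ← Measure.map_apply measurable_fst hS, Measure.map_fst_prod, measure_univ, one_smul]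
    exact measure_runSup_ge_le h ha0 ha
  have h2 : wienerPair (Prod.snd ⁻¹' {ω₂ | a ≤ runSup h ω₂}) ≤
      ENNReal.ofReal (2 * (h : ℝ) ^ 2 / ((a / 2) ^ 2 - h) ^ 2) := by
    rw [wienerPair, ← Measure.map_apply measurable_snd hS, Measure.map_snd_prod, measure_univ, one_smul]
    exact measure_runSup_ge_le h ha0 ha
  calc wienerPair {ω | a ≤ max (runSup h ω.1) (runSup h ω.2)}
      ≤ wienerPair ((Prod.fst ⁻¹' {ω₁ | a ≤ runSup h ω₁}) ∪ (Prod.snd ⁻¹' {ω₂ | a ≤ runSup h ω₂})) :=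
        measure_mono hsub
    _ ≤ _ := (measure_union_le _ _).trans (by rw [two_mul]; exact add_le_add h1 h2)

/-- **Simplified tail**: for `a ≥ 4` and `h ≤ 1`, `P(max runSup ≥ a) ≤ 2⁸ h²/a⁴`
(`(a/2)² - h ≥ a²/8` when `a² ≥ 8h`). [cite: RevuzYor1999, Ch. II Thm (1.7)] -/
theorem measure_max_runSup_ge_le' {h : ℝ≥0} (hh : (h : ℝ) ≤ 1) {a : ℝ} (ha : 4 ≤ a) :
    wienerPair {ω | a ≤ max (runSup h ω.1) (runSup h ω.2)} ≤
      ENNReal.ofReal (2 ^ 8 * (h : ℝ) ^ 2 / a ^ 4) := by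
  have hh0 : (0 : ℝ) ≤ h := h.coe_nonneg
  have ha2 : (h : ℝ) < (a / 2) ^ 2 := by nlinarith
  have hden : a ^ 2 / 8 ≤ (a / 2) ^ 2 - h := by nlinarith
  have hden_pos : 0 < a ^ 2 / 8 := by positivity
  refine (measure_max_runSup_ge_le h (by linarith) ha2).trans ?_
  rw [← ENNReal.ofReal_ofNat 2, ← ENNReal.ofReal_mul (by norm_num)]
  refine ENNReal.ofReal_le_ofReal ?_
  have h1 : ((a / 2) ^ 2 - (h : ℝ)) ^ 2 ≥ (a ^ 2 / 8) ^ 2 := by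
    exact pow_le_pow_left₀ hden_pos.le hden 2
  have h2 : 2 * (h : ℝ) ^ 2 / ((a / 2) ^ 2 - h) ^ 2 ≤ 2 * (h : ℝ) ^ 2 / (a ^ 2 / 8) ^ 2 := by
    apply div_le_div_of_nonneg_left (by positivity) (by positivity) h1
  calc 2 * (2 * (h : ℝ) ^ 2 / ((a / 2) ^ 2 - h) ^ 2) ≤ 2 * (2 * (h : ℝ) ^ 2 / (a ^ 2 / 8) ^ 2) := by
        linarith
    _ = 2 ^ 8 * (h : ℝ) ^ 2 / a ^ 4 := by
        field_simp
        ring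

end Literature.Probability.Process

end
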